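import Summits.HodgeConjecture.CorCM.OcticWeil13PairHodgeOfMarkman
import HarnessLib

/-!
# COR-CM — two `(1,3)`-positions over one octic CM field: the FAMILY form — the Hodge conjecture for `E^a × ∏_j A_j` for ANY
# finite family of CM abelian fourfolds of `k`-signature `(1,3)` whose `τ`-members take at most TWO values, GIVEN ONLY
# Markman's hyperbolic-sixfold theorem (and `2`-transitivity)

Cell `pub-hodgecm2` (COR-CM), seat b30 gen 21 (2026-08-22); count-neutral own lane OCTIC-WEIL-EIGHTFOLD — family form of
`OcticWeil13Pair.hodgeConjectureFor_biproduct_comp_vec₃_of_markmanSixfold` (the pattern of gen 20's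
`OcticWeilOrbitFamilyHodgeOfMarkman`).  Theorems only; no definition, no `sorry`; displayed named fact:
`Markman2025_weilClasses_algebraic_hyperbolicSixfold`.

* `eq_of_typeCount_one_of_meet` — two CM types of an octic `K ⊇ i(k)` of `k`-signature `(1,3)` with THE SAME member over `τ`
  are EQUAL (a `(1,3)`-type is `{s₊} ⊔ {s̄ : s over τ, s ≠ s₊}`); hence realisations are isogenous (Shimura) —
  `avDominatedBy_of_typeCount_one_of_meet`;
* **`hodgeConjectureFor_of_avDominatedBy_family₃_of_markmanSixfold`** — `A_j ⊨ (K; Φ_j)` (`j < n`) ALL of `k`-signature `(1,3)`,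
  each `Φ_j` sharing its `τ`-member with `Φ_{j₁}` or with `Φ_{j₂}`, those two being distinct, `Aut(ℂ)` `2`-transitive on the
  embeddings over `τ`, `E ⊨ (k; Ψ ∋ τ)`: every `C` dominated by `E^a × ⨁_j A_j` satisfies the Hodge conjecture (each `A_j` is
  isogenous to `A_{j₁}` or `A_{j₂}`; `Domination.AVDominatedBy.biproduct_map`, `AndreRiemann.avDominatedBy_prod_of_biproduct`).
HONEST FRAMING: conditional on the displayed Markman binder; nothing here asserts `HC_CM`.
[cite: Markman2025SecantWeil, Thm 1.5.1] [cite: Shimura1998, §6.1 Thm. 2 Cor.] [cite: MumfordAV1970, §19]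

## References
* [Markman2025SecantWeil] E. Markman, arXiv:2502.03415, Thm 1.5.1.  [Shimura1998] G. Shimura, *Abelian varieties with complex
  multiplication and modular functions*, §6.1 Theorem 2, Corollary.  [MumfordAV1970] D. Mumford, *Abelian Varieties*, §19.
  [Dodson1984] Trans. AMS 283 (1984), §3.3.2.  [Deligne1982HodgeCycles] LNM 900 (1982), §5 (c).
-/

noncomputable section

open CategoryTheory CategoryTheory.Limits NumberField

namespace Summit.HodgeConjecture.CorCM.OcticWeil13Pair

open Literature.AlgebraicGeometry Literature.AlgebraicGeometry.Motives Literature.AlgebraicGeometry.HodgeTheory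
open Literature.AlgebraicGeometry.ComplexMultiplication (IsCMTypeRealisation Shimura1998_Thm2_Cor_holds)
open Literature.AlgebraicTopology.SingularHomology
open Literature.NumberTheory.ComplexMultiplication
open Summit.HodgeConjecture.CorCM.Census.OcticWeilOrbit (permTab_facts)
open Summit.HodgeConjecture.CorCM.Census.OcticWeilMixed (signTabM signTabM_two)
open Summit.HodgeConjecture.CorCM.OcticWeilOrbit (card_filter_symm_true)
open Summit.HodgeConjecture.CorCM.OcticWeilMixed (mem_iff_of_single)
open Summit.HodgeConjecture.CorCM.Domination (AVDominatedBy)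
open Summit.HodgeConjecture.CorCM.AndreRiemann (sumFam avDominatedBy_prod_of_biproduct avDominatedBy_biproduct_reindex)

open scoped Classical

section Family

variable {K : Type} [Field K] [NumberField K] [IsCMField K] {k : Type} [Field k] [NumberField k] [IsCMField k]

omit [IsCMField K] [IsCMField k] in
/-- **A `(1,3)`-type is determined by its member over `τ`**: two CM types of the octic `K ⊇ i(k)` with ONE member over `τ`
each, in common, are equal (both read `(e s).2 = [(e s).1 = 0]` in a frame of the second). [cite: Deligne1982HodgeCycles, §5 (c)] -/
theorem eq_of_typeCount_one_of_meet (h8 : Module.finrank ℚ K = 8) (h2 : Module.finrank ℚ k = 2) (i : k →+* K)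
    {τ : k →+* ℂ} (hττ : ComplexEmbedding.conjugate τ ≠ τ) (hk : ∀ σ : k →+* ℂ, σ = τ ∨ σ = ComplexEmbedding.conjugate τ)
    {Φ₁ Φ₂ : CMType K}
    (h13₁ : (Finset.univ.filter fun s : K →+* ℂ => s.comp i = τ ∧ s ∈ Φ₁.1).card = 1)
    (h13₂ : (Finset.univ.filter fun s : K →+* ℂ => s.comp i = τ ∧ s ∈ Φ₂.1).card = 1)
    (hmeet : (Finset.univ.filter fun s : K →+* ℂ => s.comp i = τ ∧ (s ∈ Φ₁.1 ∧ s ∈ Φ₂.1)).card = 1) : Φ₁ = Φ₂ := by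
  obtain ⟨e, he_sign, he_conj, hr₂⟩ := OcticCurveFourfold.exists_frame h8 h2 i hττ hk Φ₂ h13₂
  have hread₂ : ∀ s, s ∈ Φ₂.1 ↔ (e s).2 = decide ((e s).1 = 0) := fun s =>
    (hr₂ s).trans (inr_mem_phi_iff_decide (e s))
  -- the label of the `τ`-member of `Φ₁`
  obtain ⟨a₁, ha₁'⟩ := Finset.card_eq_one.1
    (show (Finset.univ.filter fun a : Fin 4 => e.symm (a, true) ∈ Φ₁.1).card = 1 by
      rw [card_filter_symm_true he_sign (fun s => s ∈ Φ₁.1)]; exact h13₁)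
  have ha₁ : ∀ a : Fin 4, e.symm (a, true) ∈ Φ₁.1 ↔ a = a₁ := fun a => by
    have h : a ∈ (Finset.univ.filter fun a : Fin 4 => e.symm (a, true) ∈ Φ₁.1) ↔ a ∈ ({a₁} : Finset (Fin 4)) := by
      rw [ha₁']
    simpa using h
  -- it is `0`, the label of the `τ`-member of `Φ₂`
  have ha₁0 : a₁ = 0 := by
    have h1 : (Finset.univ.filter fun a : Fin 4 => e.symm (a, true) ∈ Φ₁.1 ∧ e.symm (a, true) ∈ Φ₂.1).card = 1 := by
      rw [card_filter_symm_true he_sign (fun s => s ∈ Φ₁.1 ∧ s ∈ Φ₂.1)]; exact hmeet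
    obtain ⟨a, ha⟩ := Finset.card_eq_one.1 h1
    have hamem : a ∈ Finset.univ.filter fun a : Fin 4 => e.symm (a, true) ∈ Φ₁.1 ∧ e.symm (a, true) ∈ Φ₂.1 := by
      rw [ha]; exact Finset.mem_singleton_self a
    obtain ⟨-, hΦ₁, hΦ₂⟩ := Finset.mem_filter.1 hamem
    rw [hread₂, Equiv.apply_symm_apply] at hΦ₂
    rw [← (ha₁ a).1 hΦ₁]
    exact of_decide_eq_true hΦ₂.symm
  subst ha₁0
  have hread₁ : ∀ s, s ∈ Φ₁.1 ↔ (e s).2 = decide ((e s).1 = 0) := fun s => by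
    rw [mem_iff_of_single he_conj ha₁ s, signTabM_two, permTab_facts.2.2]; rfl
  exact Subtype.ext (Set.ext fun s => (hread₁ s).trans (hread₂ s).symm)

omit [IsCMField k] in
/-- **Realisations of `(1,3)`-types with the same member over `τ` are isogenous**, hence one dominates the other (Shimura's
uniqueness of the isogeny class of a CM type). [cite: Shimura1998, §6.1 Thm. 2 Cor.] -/
theorem avDominatedBy_of_typeCount_one_of_meet (h8 : Module.finrank ℚ K = 8) (h2 : Module.finrank ℚ k = 2) (i : k →+* K)
    {τ : k →+* ℂ} (hττ : ComplexEmbedding.conjugate τ ≠ τ) (hk : ∀ σ : k →+* ℂ, σ = τ ∨ σ = ComplexEmbedding.conjugate τ)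
    {Φ₁ Φ₂ : CMType K}
    (h13₁ : (Finset.univ.filter fun s : K →+* ℂ => s.comp i = τ ∧ s ∈ Φ₁.1).card = 1)
    (h13₂ : (Finset.univ.filter fun s : K →+* ℂ => s.comp i = τ ∧ s ∈ Φ₂.1).card = 1)
    (hmeet : (Finset.univ.filter fun s : K →+* ℂ => s.comp i = τ ∧ (s ∈ Φ₁.1 ∧ s ∈ Φ₂.1)).card = 1)
    {A₁ : AbelianVariety ℂ} {ι₁ : 𝓞 K →+* End A₁} {θ₁ : K →+* Module.End ℂ (complexBetti A₁.X 1)}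
    (hA₁ : IsCMTypeRealisation Φ₁ A₁ ι₁ θ₁)
    {A₂ : AbelianVariety ℂ} {ι₂ : 𝓞 K →+* End A₂} {θ₂ : K →+* Module.End ℂ (complexBetti A₂.X 1)}
    (hA₂ : IsCMTypeRealisation Φ₂ A₂ ι₂ θ₂) : AVDominatedBy A₁ A₂ := by
  obtain rfl := eq_of_typeCount_one_of_meet h8 h2 i hττ hk h13₁ h13₂ hmeet
  obtain ⟨g, hg, -⟩ := Shimura1998_Thm2_Cor_holds K Φ₁ A₁ ι₁ θ₁ A₂ ι₂ θ₂ hA₁ hA₂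
  exact AVDominatedBy.of_isIsogeny_hom hg (AVDominatedBy.refl A₂)

variable {n : ℕ} {Φ : Fin n → CMType K} {A : Fin n → AbelianVariety ℂ} {ι : ∀ j, 𝓞 K →+* End (A j)}
  {θ : ∀ j, K →+* Module.End ℂ (complexBetti (A j).X 1)}
  {Ψ : CMType k} {E : AbelianVariety ℂ} {ιE : 𝓞 k →+* End E} {θE : k →+* Module.End ℂ (complexBetti E.X 1)}

/-- **THE FAMILY FORM.**  `K` ANY CM field of degree `8`, `k` imaginary quadratic, `i : k → K`, `τ : k → ℂ` with `Aut(ℂ)`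
`2`-transitive on the four embeddings of `K` over `τ` (`h2T`); `A_j ⊨ (K; Φ_j)` (`j < n`) CM abelian fourfolds ALL of
`k`-signature `(1,3)`, each `Φ_j` sharing its member over `τ` with `Φ_{j₁}` or with `Φ_{j₂}` (`hpos`), those two members being
distinct (`hdist`) — e.g. Galois conjugates `σB'`, with any CM structures and polarisations, of one CM fourfold, falling into
two `τ`-positions; `E ⊨ (k; Ψ ∋ τ)`.  Then every `C` dominated by `E^a × ⨁_j A_j` satisfies the Hodge conjecture, GIVEN ONLY
Markman's hyperbolic-sixfold theorem. [cite: Markman2025SecantWeil, Thm 1.5.1] [cite: Shimura1998, §6.1 Thm. 2 Cor.]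
[cite: MumfordAV1970, §19] [cite: Dodson1984, §3.3.2 Theorem] -/
theorem hodgeConjectureFor_of_avDominatedBy_family₃_of_markmanSixfold
    (hM6 : Markman2025_weilClasses_algebraic_hyperbolicSixfold)
    (h8 : Module.finrank ℚ K = 8) (h2 : Module.finrank ℚ k = 2) (i : k →+* K)
    (hA : ∀ j, IsCMTypeRealisation (Φ j) (A j) (ι j) (θ j)) {τ : k →+* ℂ}
    (h13 : ∀ j, (Finset.univ.filter fun s : K →+* ℂ => s.comp i = τ ∧ s ∈ (Φ j).1).card = 1) (j₁ j₂ : Fin n)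
    (hdist : (Finset.univ.filter fun s : K →+* ℂ => s.comp i = τ ∧ (s ∈ (Φ j₁).1 ∧ s ∈ (Φ j₂).1)).card = 0)
    (hpos : ∀ j, (Finset.univ.filter fun s : K →+* ℂ => s.comp i = τ ∧ (s ∈ (Φ j).1 ∧ s ∈ (Φ j₁).1)).card = 1 ∨
      (Finset.univ.filter fun s : K →+* ℂ => s.comp i = τ ∧ (s ∈ (Φ j).1 ∧ s ∈ (Φ j₂).1)).card = 1)
    (h2T : ∀ s t s' t' : K →+* ℂ, s.comp i = τ → t.comp i = τ → s'.comp i = τ → t'.comp i = τ → s ≠ t → s' ≠ t' →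
      ∃ ρ : ℂ ≃+* ℂ, (ρ : ℂ →+* ℂ).comp s = s' ∧ (ρ : ℂ →+* ℂ).comp t = t')
    (hE : IsCMTypeRealisation Ψ E ιE θE) (hτΨ : τ ∈ Ψ.1) (a : ℕ)
    {C : AbelianVariety ℂ} (hC : AVDominatedBy C ((⨁ fun _ : Fin a => E).prod (⨁ A))) :
    HodgeConjectureFor C.dim C.X := by
  have hττ : ComplexEmbedding.conjugate τ ≠ τ := QuarticCM.conjugate_ne τ
  have hk : ∀ σ : k →+* ℂ, σ = τ ∨ σ = ComplexEmbedding.conjugate τ := fun σ =>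
    QuarticCM.eq_or_eq_conjugate_of_quadratic h2 τ σ
  -- each `A_j` is dominated by `A_{j₁}` or `A_{j₂}`
  let Bv : Fin 2 → AbelianVariety ℂ := ![A j₁, A j₂]
  have hdomB : ∀ j, ∃ m : Fin 2, AVDominatedBy (A j) (Bv m) := by
    intro j
    rcases hpos j with h | h
    · exact ⟨0, avDominatedBy_of_typeCount_one_of_meet h8 h2 i hττ hk (h13 j) (h13 j₁) h (hA j) (hA j₁)⟩
    · exact ⟨1, avDominatedBy_of_typeCount_one_of_meet h8 h2 i hττ hk (h13 j) (h13 j₂) h (hA j) (hA j₂)⟩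
  choose m hm using hdomB
  -- domination of `E^a × ⨁ A` by a product of copies of `E, A j₁, A j₂`
  let Y : Fin 3 → AbelianVariety ℂ := ![E, A j₁, A j₂]
  have hYsucc : ∀ m : Fin 2, Y m.succ = Bv m := fun m => rfl
  have h₁ : AVDominatedBy (⨁ fun _ : Fin a => E) (⨁ fun _ : Fin a => Y 0) :=
    AVDominatedBy.biproduct_map fun _ => AVDominatedBy.refl E
  have h₂ : AVDominatedBy (⨁ A) (⨁ fun j => Y (m j).succ) :=
    AVDominatedBy.biproduct_map fun j => by rw [hYsucc]; exact hm j
  have h₁₂' := avDominatedBy_prod_of_biproduct h₁ h₂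
  let κ' : Fin a ⊕ Fin n → Fin 3 := Sum.elim (fun _ => 0) fun j => (m j).succ
  have hfam : sumFam (fun _ : Fin a => Y 0) (fun j => Y (m j).succ) = Y ∘ κ' := funext fun x => by
    cases x <;> rfl
  rw [hfam] at h₁₂'
  have hdom := avDominatedBy_biproduct_reindex finSumFinEquiv.symm h₁₂'
  exact Domination.hodgeConjectureFor_of_avDominatedBy
    (hodgeConjectureFor_biproduct_comp_vec₃_of_markmanSixfold hM6 h8 h2 i (hA j₁) (hA j₂) hE hτΨ (h13 j₁) (h13 j₂) hdist
      h2T (κ' ∘ finSumFinEquiv.symm)) (hC.trans hdom)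

end Family

end Summit.HodgeConjecture.CorCM.OcticWeil13Pair

end
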